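import Literature.Probability.LatticeModels.RandomClusterMonotonic
import Literature.Probability.LatticeModels.RandomClusterComparison
import Literature.Probability.LatticeModels.FKIsingAnnulusCrossingProofs
import HarnessLib

/-!
# Conditioning the random-cluster measure on the configuration off a region: domination by a wired measure of the region, proved

Topic `Literature/Probability/LatticeModels` (trunk `StatMech`). For the finite-graph
random-cluster measure `φ = φ^B_{G,p,q} = rcMeasure G p q B` (`RandomCluster.lean`), `q ≥ 1`,
a set `U ⊆ E(G)` of edges (the *region*, e.g. the unexplored edges of an annulus) and a
configuration `ξ` of the edges off `U` (the explored edges and the edges outside the annulus),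
the conditional law of `ω ∩ U` given `ω ∖ U = ξ` is the random-cluster measure of the spanning
graph `⟨U⟩` with the boundary condition *induced* by `ξ`: two vertices of `U` are wired when
`ξ ∪ B` joins them (Grimmett 2006, Lemma (4.13), the nesting property; Duminil-Copin–Smirnov
2012, §3.2, domain Markov property). The tree's `rcMeasure` wires a single vertex set, which
cannot express an arbitrary induced boundary condition; what successive-conditioning arguments
consume, however, is only the *comparison* of the conditional law with an extremal one
(Grimmett 2006, Lemma (4.14)(b); DCS 2012, Thm. 3.1 "comparison between boundary conditions"),
and that is proved here directly, in H21's formalism and without any hypothesis on `ξ`: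

* `rcMeasure_real_inter_cylinder_le_mul_fromEdgeSet` — **for increasing events the conditional
  law is dominated by the measure of `⟨U⟩` wired on every vertex touched by an open edge of `ξ`**
  (and on `B`): if `W ⊇ B` contains both endpoints of every edge of `ξ`, then for every
  increasing `A`,
  `φ^B_G({ω ∩ U ∈ A} ∩ {ω ∖ U = ξ}) ≤ φ^B_G({ω ∖ U = ξ}) · φ^W_{⟨U⟩}(A)`,
  i.e. `φ^B_G(ω ∩ U ∈ A | ω ∖ U = ξ) ≤ φ^W_{⟨U⟩,p,q}(A)`. The induced boundary condition only
  wires vertices of `W`, and wiring all of `W` into one class is coarser (Grimmett's `ξ ≤ 1`).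
  In a planar exploration whose frontier towards `U` consists of *closed* edges, the open edges
  of `ξ` touch `U` only along the outer boundary, so `W` may be taken to be "`B` and the boundary
  vertices" — the step "the probability for each crossing is smaller than the probability that
  there is a crossing with wired boundary conditions" of DCS 2012, p. 27.
* `rcMeasure_real_inter_cylinder_le_mul_fromEdgeSet_of_isLowerSet` — **for decreasing events
  the conditional law is dominated by the measure of `⟨U⟩` wired on `B` only** (all edges off
  `U` closed, Grimmett's `ξ ≥ 0`): `φ^B_G({ω ∩ U ∈ D} ∩ {ω ∖ U = ξ}) ≤ φ^B_G({ω ∖ U = ξ}) ·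
  φ^B_{⟨U⟩}(D)`.

* `rcMeasure_real_inter_cylinder_empty_eq_mul_fromEdgeSet` — **conditioning on all edges off
  `U` being closed gives exactly the measure of `⟨U⟩`** (Grimmett 2006, Thm. (3.1)(a), (3.2) with
  `j = 0`, edge by edge): `φ^B_G({ω ∩ U ∈ A} ∩ {ω ∖ U = ∅}) = φ^B_G({ω ∖ U = ∅}) · φ^B_{⟨U⟩}(A)`
  for every event `A`; hence `φ^B_{⟨U⟩}(A) ≤ φ^B_G({ω ∩ U ∈ A})` for increasing `A`
  (`rcMeasure_fromEdgeSet_real_le`: "increasing given decreasing is at most unconditional").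

The first two are Holley's inequality (Mathlib `holley`) between the conditional weights
`a ↦ w^B_G(a ∪ ξ)` on the edge sets `a ⊆ U` and the weights of `⟨U⟩`; Holley's condition is the
lattice inequality `k^B(a ∪ ξ) + k^W(b) ≤ k^B((a ∩ b) ∪ ξ) + k^W(a ∪ b)`
(`clusterCount_union_add_clusterCount_le`), from the supermodularity and antitonicity of the
number of connected components (`card_connectedComponent_supermodular`, `RandomClusterFKG`).
Everything is proved; no definitions. Imports: `FKIsingAnnulusCrossingProofs` only for the
generic lemmas `wired_mono`, `edgeFinset_fromEdgeSet_of_subset`, `sum_powerset_edgeFinset_split`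
(a librarian may move them next to `rcMeasure`), `RandomClusterComparison` for `clusterCount_anti`
and the arithmetic lemma `rcWeight_holley_aux`.

## References

* G. Grimmett, *The Random-Cluster Model*, Springer (2006): §4.2 (4.11)–(4.13), Lemma (4.13)
  (nesting / domain Markov), Lemma (4.14)(b) (comparison between boundary conditions), Thm. (2.1)
  and Thm. (2.24) (Holley; monotonic measures), Thm. (3.8).
* H. Duminil-Copin, S. Smirnov, *Conformal invariance of lattice models*, Clay Math. Proc. 15
  (2012) 213–276 (arXiv:1109.1549): Thm. 3.1, §3.2 (domain Markov property), §6.1 p. 27.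
* R. Holley, *Remarks on the FKG inequalities*, Comm. Math. Phys. 36 (1974) 227–231; Mathlib
  `Mathlib.Combinatorics.SetFamily.FourFunctions` (`holley`).
-/

noncomputable section

open MeasureTheory Finset SimpleGraph

namespace Literature.Probability.LatticeModels

/-! ### The lattice inequality behind conditioning -/

section ClusterCount

variable {V : Type*} [Finite V]

/-- **Mixed supermodularity of cluster counts with a frozen configuration**: for edge sets
`a, b`, a frozen configuration `ξ`, and wired sets `B ⊆ W` such that every edge of `ξ` has both
endpoints in `W`, `k^B(a ∪ ξ) + k^W(b) ≤ k^B((a ∩ b) ∪ ξ) + k^W(a ∪ b)` (the graphs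
`⟨(a ∩ b) ∪ ξ⟩ ∨ K_B` and `⟨a ∪ b⟩ ∨ K_W` lie below the meet, resp. the join, of `⟨a ∪ ξ⟩ ∨ K_B` and
`⟨b⟩ ∨ K_W`, because `⟨ξ⟩ ≤ K_W`; then supermodularity and antitonicity of the number of
components, Grimmett 2006, (3.12)). [cite: Grimmett2006, Thm. (3.8), eq. (3.12)] -/
theorem clusterCount_union_add_clusterCount_le {a b ξ : Percolation.BondConfig V} {B W : Set V}
    (hBW : B ⊆ W) (hξ : ∀ e ∈ ξ, ∀ x ∈ e, x ∈ W) :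
    clusterCount (a ∪ ξ) B + clusterCount b W ≤
      clusterCount ((a ∩ b) ∪ ξ) B + clusterCount (a ∪ b) W := by
  unfold clusterCount Percolation.openGraph
  have hw : wired B ≤ wired W := wired_mono hBW
  have hξW : fromEdgeSet ξ ≤ wired W := by
    intro x y hxy
    rw [fromEdgeSet_adj] at hxy
    rw [wired_adj]
    exact ⟨hxy.2, hξ _ hxy.1 x (Sym2.mem_mk_left x y), hξ _ hxy.1 y (Sym2.mem_mk_right x y)⟩
  rw [fromEdgeSet_union, fromEdgeSet_union, fromEdgeSet_union, fromEdgeSet_inter]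
  set H₁ : SimpleGraph V := fromEdgeSet a ⊔ fromEdgeSet ξ ⊔ wired B with hH₁
  set H₂ : SimpleGraph V := fromEdgeSet b ⊔ wired W with hH₂
  have ha₁ : fromEdgeSet a ≤ H₁ := le_sup_left.trans le_sup_left
  have hξ₁ : fromEdgeSet ξ ≤ H₁ := le_sup_right.trans le_sup_left
  have hB₁ : wired B ≤ H₁ := le_sup_right
  have hb₂ : fromEdgeSet b ≤ H₂ := le_sup_left
  have hW₂ : wired W ≤ H₂ := le_sup_right
  have h1 : fromEdgeSet a ⊓ fromEdgeSet b ⊔ fromEdgeSet ξ ⊔ wired B ≤ H₁ ⊓ H₂ :=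
    sup_le (sup_le (inf_le_inf ha₁ hb₂) (le_inf hξ₁ (hξW.trans hW₂)))
      (le_inf hB₁ (hw.trans hW₂))
  have h2 : fromEdgeSet a ⊔ fromEdgeSet b ⊔ wired W ≤ H₁ ⊔ H₂ :=
    sup_le (sup_le (ha₁.trans le_sup_left) (hb₂.trans le_sup_right)) (hW₂.trans le_sup_right)
  calc Nat.card H₁.ConnectedComponent + Nat.card H₂.ConnectedComponent
      ≤ Nat.card (H₁ ⊓ H₂).ConnectedComponent + Nat.card (H₁ ⊔ H₂).ConnectedComponent :=
        card_connectedComponent_supermodular _ _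
    _ ≤ Nat.card (fromEdgeSet a ⊓ fromEdgeSet b ⊔ fromEdgeSet ξ ⊔ wired B).ConnectedComponent +
          Nat.card (fromEdgeSet a ⊔ fromEdgeSet b ⊔ wired W).ConnectedComponent :=
        add_le_add (ConnectedComponent.card_le_card_of_le h1)
          (ConnectedComponent.card_le_card_of_le h2)

/-- The mirror inequality, for the domination from below: for `B₀ ⊆ B`,
`k^{B₀}(a) + k^B(b ∪ ξ) ≤ k^{B₀}(a ∩ b) + k^B((a ∪ b) ∪ ξ)` (no hypothesis on `ξ`).
[cite: Grimmett2006, Thm. (3.8), eq. (3.12)] -/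
theorem clusterCount_add_clusterCount_union_le {a b ξ : Percolation.BondConfig V} {B₀ B : Set V}
    (hB : B₀ ⊆ B) :
    clusterCount a B₀ + clusterCount (b ∪ ξ) B ≤
      clusterCount (a ∩ b) B₀ + clusterCount ((a ∪ b) ∪ ξ) B := by
  unfold clusterCount Percolation.openGraph
  have hw : wired B₀ ≤ wired B := wired_mono hB
  rw [fromEdgeSet_union, fromEdgeSet_union, fromEdgeSet_union, fromEdgeSet_inter]
  set H₁ : SimpleGraph V := fromEdgeSet a ⊔ wired B₀ with hH₁
  set H₂ : SimpleGraph V := fromEdgeSet b ⊔ fromEdgeSet ξ ⊔ wired B with hH₂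
  have ha₁ : fromEdgeSet a ≤ H₁ := le_sup_left
  have hB₁ : wired B₀ ≤ H₁ := le_sup_right
  have hb₂ : fromEdgeSet b ≤ H₂ := le_sup_left.trans le_sup_left
  have hξ₂ : fromEdgeSet ξ ≤ H₂ := le_sup_right.trans le_sup_left
  have hW₂ : wired B ≤ H₂ := le_sup_right
  have h1 : fromEdgeSet a ⊓ fromEdgeSet b ⊔ wired B₀ ≤ H₁ ⊓ H₂ :=
    sup_le (inf_le_inf ha₁ hb₂) (le_inf hB₁ (hw.trans hW₂))
  have h2 : fromEdgeSet a ⊔ fromEdgeSet b ⊔ fromEdgeSet ξ ⊔ wired B ≤ H₁ ⊔ H₂ :=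
    sup_le (sup_le (sup_le (ha₁.trans le_sup_left) (hb₂.trans le_sup_right))
      (hξ₂.trans le_sup_right)) (hW₂.trans le_sup_right)
  calc Nat.card H₁.ConnectedComponent + Nat.card H₂.ConnectedComponent
      ≤ Nat.card (H₁ ⊓ H₂).ConnectedComponent + Nat.card (H₁ ⊔ H₂).ConnectedComponent :=
        card_connectedComponent_supermodular _ _
    _ ≤ Nat.card (fromEdgeSet a ⊓ fromEdgeSet b ⊔ wired B₀).ConnectedComponent +
          Nat.card (fromEdgeSet a ⊔ fromEdgeSet b ⊔ fromEdgeSet ξ ⊔ wired B).ConnectedComponent :=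
        add_le_add (ConnectedComponent.card_le_card_of_le h1)
          (ConnectedComponent.card_le_card_of_le h2)

end ClusterCount

/-! ### Sums over a cylinder -/

section SetLemmas

variable {V : Type*} [DecidableEq V]

/-- For `η ⊆ U` and `ζ` disjoint from `U`, the part of `η ∪ ζ` off `U` is `ζ`:
`↑(η ∪ ζ) ∩ (↑U)ᶜ = ↑ζ`. [folklore] -/
theorem coe_union_inter_compl_eq {U η ζ : Finset (Sym2 V)} (hη : η ⊆ U) (hζ : Disjoint ζ U) :
    (↑(η ∪ ζ) : Set (Sym2 V)) ∩ (↑U)ᶜ = ↑ζ := by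
  ext e
  simp only [Set.mem_inter_iff, Finset.mem_coe, Finset.mem_union, Set.mem_compl_iff]
  constructor
  · rintro ⟨h | h, heU⟩
    · exact absurd (hη h) heU
    · exact h
  · exact fun h ↦ ⟨Or.inr h, Finset.disjoint_left.1 hζ h⟩

/-- For `η ⊆ U` and `ζ` disjoint from `U`, the part of `η ∪ ζ` inside `U` is `η`. [folklore] -/
theorem union_inter_eq_of_subset_of_disjoint {U η ζ : Finset (Sym2 V)} (hη : η ⊆ U)
    (hζ : Disjoint ζ U) : (η ∪ ζ) ∩ U = η := by
  rw [Finset.union_inter_distrib_right, Finset.inter_eq_left.2 hη,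
    Finset.disjoint_iff_inter_eq_empty.1 hζ, Finset.union_empty]

end SetLemmas

section Finite

variable {V : Type*} [Fintype V] [DecidableEq V] (G : SimpleGraph V) [DecidableRel G.Adj]

/-- **Sums over a cylinder.** For a region `U ⊆ E(G)`, a configuration `ζ₀ ⊆ E(G) ∖ U` off the
region and any function `F` of the configuration inside the region,
`∑_{ω ⊆ E, ω ∖ U = ζ₀} w(ω) F(ω ∩ U) = ∑_{η ⊆ U} w(η ∪ ζ₀) F(η)` (reindex `ω = η ∪ ζ₀`).
[folklore] -/
theorem sum_cylinder_eq_sum_powerset (w F : Finset (Sym2 V) → ℝ) {U ζ₀ : Finset (Sym2 V)}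
    (hU : U ⊆ G.edgeFinset) (hζ₀ : ζ₀ ⊆ G.edgeFinset \ U) :
    ∑ ω ∈ G.edgeFinset.powerset,
        (if (↑ω : Set (Sym2 V)) ∩ (↑U)ᶜ = ↑ζ₀ then w ω * F (ω ∩ U) else 0) =
      ∑ η ∈ U.powerset, w (η ∪ ζ₀) * F η := by
  rw [sum_powerset_edgeFinset_split G U hU]
  refine Finset.sum_congr rfl fun η hη ↦ ?_
  rw [Finset.mem_powerset] at hη
  have hζ₀U : Disjoint ζ₀ U := Finset.disjoint_of_subset_left hζ₀ sdiff_disjoint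
  calc ∑ ζ ∈ (G.edgeFinset \ U).powerset,
        (if (↑(η ∪ ζ) : Set (Sym2 V)) ∩ (↑U)ᶜ = ↑ζ₀ then w (η ∪ ζ) * F ((η ∪ ζ) ∩ U) else 0)
      = ∑ ζ ∈ (G.edgeFinset \ U).powerset, (if ζ = ζ₀ then w (η ∪ ζ₀) * F η else 0) := by
        refine Finset.sum_congr rfl fun ζ hζ ↦ ?_
        rw [Finset.mem_powerset] at hζ
        have hζU : Disjoint ζ U := Finset.disjoint_of_subset_left hζ sdiff_disjoint
        have hiff : ((↑(η ∪ ζ) : Set (Sym2 V)) ∩ (↑U)ᶜ = ↑ζ₀) ↔ ζ = ζ₀ := by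
          rw [coe_union_inter_compl_eq hη hζU, Finset.coe_inj]
        by_cases h : ζ = ζ₀
        · rw [if_pos (hiff.2 h), if_pos h, union_inter_eq_of_subset_of_disjoint hη hζU, h]
        · rw [if_neg (fun h' ↦ h (hiff.1 h')), if_neg h]
    _ = w (η ∪ ζ₀) * F η := by
        rw [Finset.sum_ite_eq']
        exact if_pos (Finset.mem_powerset.2 hζ₀)

/-- The random-cluster measure of "the configuration inside `U` lies in `A` and the configuration
off `U` is `ζ₀`" as a sum over the configurations of the region:
`Z · φ({ω ∩ U ∈ A} ∩ {ω ∖ U = ζ₀}) = ∑_{η ⊆ U, η ∈ A} w(η ∪ ζ₀)`. [cite: Grimmett2006, §4.2, eq. (4.12)] -/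
theorem rcPartitionFunction_mul_real_inter_cylinder {p q : ℝ} (hp : p ∈ Set.Icc (0 : ℝ) 1)
    (hq : 0 < q) (B : Set V) {U ζ₀ : Finset (Sym2 V)} (hU : U ⊆ G.edgeFinset)
    (hζ₀ : ζ₀ ⊆ G.edgeFinset \ U) (A : Set (Percolation.BondConfig V)) [DecidablePred (· ∈ A)] :
    rcPartitionFunction G p q B *
        (rcMeasure G p q B).real
          ({ω | ω ∩ ↑U ∈ A} ∩ {ω | ω ∩ (↑U : Set (Sym2 V))ᶜ = ↑ζ₀}) =
      ∑ η ∈ U.powerset,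
        rcWeight G p q B (η ∪ ζ₀) * (if (↑η : Percolation.BondConfig V) ∈ A then 1 else 0) := by
  classical
  have hZ := rcPartitionFunction_pos G hp hq B
  rw [rcMeasure_real_apply G hp hq B, Finset.mul_sum,
    ← sum_cylinder_eq_sum_powerset G (rcWeight G p q B)
      (fun η ↦ if (↑η : Percolation.BondConfig V) ∈ A then (1 : ℝ) else 0) hU hζ₀]
  refine Finset.sum_congr rfl fun ω _ ↦ ?_
  have hωU : ((↑ω : Percolation.BondConfig V) ∩ ↑U ∈ A) ↔ ((↑(ω ∩ U) : Percolation.BondConfig V) ∈ A) := by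
    rw [Finset.coe_inter]
  by_cases hC : (↑ω : Set (Sym2 V)) ∩ (↑U)ᶜ = ↑ζ₀
  · by_cases hA : (↑ω : Percolation.BondConfig V) ∩ ↑U ∈ A
    · have hA' := hωU.1 hA
      rw [if_pos ⟨hA, hC⟩, if_pos hC, if_pos hA']
      field_simp
    · have hA' : (↑(ω ∩ U) : Percolation.BondConfig V) ∉ A := fun h ↦ hA (hωU.2 h)
      rw [if_neg (fun h ↦ hA h.1), if_pos hC, if_neg hA', mul_zero, mul_zero]
  · rw [if_neg (fun h ↦ hC h.2), if_neg hC, mul_zero]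

/-! ### Domination of the conditional law, increasing events -/

/-- **Conditionally on the configuration off a region, the random-cluster measure inside the
region is dominated by the measure of the region wired on the touched vertices** (Grimmett 2006,
Lemma (4.13) with Lemma (4.14)(b): the conditional law given `T_Λ` is `φ^ξ_Λ ≤_st φ^1_Λ`;
Duminil-Copin–Smirnov 2012, §3.2 domain Markov property with Thm. 3.1, comparison between
boundary conditions — combined, in H21's one-wired-set formalism). Let `U ⊆ E(G)` be a set of
edges, `⟨U⟩ = fromEdgeSet U` the spanning graph it defines, `ξ` any configuration (of the edges
off `U`), and `W ⊇ B` a vertex set containing both endpoints of every edge of `ξ`. Then for every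
increasing event `A`,
`φ^B_{G,p,q}({ω ∩ U ∈ A} ∩ {ω ∖ U = ξ}) ≤ φ^B_{G,p,q}({ω ∖ U = ξ}) · φ^W_{⟨U⟩,p,q}(A)`
(`0 ≤ p ≤ 1`, `q ≥ 1`), i.e. `φ^B_G(ω ∩ U ∈ A | ω ∖ U = ξ) ≤ φ^W_{⟨U⟩}(A)` whenever the
conditioning event is non-null. Proof: Holley's inequality between the conditional weights
`a ↦ w^B_G(a ∪ ξ)`, `a ⊆ U`, and the weights `w^W_{⟨U⟩}`, whose condition is
`clusterCount_union_add_clusterCount_le`. [cite: Grimmett2006, Lemma (4.13) and Lemma (4.14)(b)] -/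
theorem rcMeasure_real_inter_cylinder_le_mul_fromEdgeSet {p q : ℝ} (hp : p ∈ Set.Icc (0 : ℝ) 1)
    (hq : 1 ≤ q) (B : Set V) (U : Finset (Sym2 V)) (hU : U ⊆ G.edgeFinset) (ξ : Set (Sym2 V))
    {W : Set V} (hBW : B ⊆ W) (hξW : ∀ e ∈ ξ, ∀ x ∈ e, x ∈ W)
    {A : Set (Percolation.BondConfig V)} (hA : IsUpperSet A) :
    (rcMeasure G p q B).real ({ω | ω ∩ ↑U ∈ A} ∩ {ω | ω ∩ (↑U : Set (Sym2 V))ᶜ = ξ}) ≤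
      (rcMeasure G p q B).real {ω | ω ∩ (↑U : Set (Sym2 V))ᶜ = ξ} *
        (rcMeasure (fromEdgeSet (U : Set (Sym2 V))) p q W).real A := by
  classical
  have hq0 : 0 < q := one_pos.trans_le hq
  have hZ := rcPartitionFunction_pos G hp hq0 B
  haveI : IsProbabilityMeasure (rcMeasure G p q B) := isProbabilityMeasure_rcMeasure G hp hq0 B
  set φ := rcMeasure G p q B with hφ
  set X : Set (Percolation.BondConfig V) := {ω | ω ∩ ↑U ∈ A} with hX
  set C : Set (Percolation.BondConfig V) := {ω | ω ∩ (↑U : Set (Sym2 V))ᶜ = ξ} with hC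
  -- the configuration off `U` as a finite edge set `ζ₀ ⊆ E ∖ U`, or the cylinder is null
  by_cases hex : ∃ ω₀ : Finset (Sym2 V), ω₀ ⊆ G.edgeFinset ∧ (↑ω₀ : Set (Sym2 V)) ∩ (↑U)ᶜ = ξ
  swap
  · have hC0 : φ.real C = 0 := by
      rw [hφ, rcMeasure_real_apply G hp hq0 B C]
      refine Finset.sum_eq_zero fun ω hω ↦ if_neg fun hωC ↦ hex ⟨ω, Finset.mem_powerset.1 hω, hωC⟩
    have h0 : φ.real (X ∩ C) = 0 :=
      le_antisymm ((measureReal_mono Set.inter_subset_right (measure_ne_top φ C)).trans hC0.le)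
        measureReal_nonneg
    rw [h0, hC0, zero_mul]
  obtain ⟨ω₀, hω₀E, hω₀⟩ := hex
  set ζ₀ : Finset (Sym2 V) := ω₀ \ U with hζ₀def
  have hζ₀ : (↑ζ₀ : Set (Sym2 V)) = ξ := by rw [hζ₀def, Finset.coe_sdiff]; exact hω₀
  have hζ₀E : ζ₀ ⊆ G.edgeFinset \ U := Finset.sdiff_subset_sdiff hω₀E le_rfl
  have hζ₀U : Disjoint ζ₀ U := Finset.disjoint_of_subset_left hζ₀E sdiff_disjoint
  have hξW' : ∀ e ∈ (↑ζ₀ : Set (Sym2 V)), ∀ x ∈ e, x ∈ W := by rw [hζ₀]; exact hξW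
  -- the graph `⟨U⟩` (its edge set is `U`, for every `Fintype` instance)
  set GU : SimpleGraph V := fromEdgeSet (U : Set (Sym2 V)) with hGU
  have hEU : ∀ i : Fintype GU.edgeSet, @SimpleGraph.edgeFinset V GU i = U := fun i ↦
    @edgeFinset_fromEdgeSet_of_subset V _ G _ U hU i
  have hZU := rcPartitionFunction_pos GU hp hq0 W
  -- the normaliser of the conditional law
  set N : ℝ := ∑ η ∈ U.powerset, rcWeight G p q B (η ∪ ζ₀) with hN
  have hNC : rcPartitionFunction G p q B * φ.real C = N := by
    have h := rcPartitionFunction_mul_real_inter_cylinder G hp hq0 B hU hζ₀E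
      (Set.univ : Set (Percolation.BondConfig V))
    rw [hζ₀] at h
    simp only [Set.mem_univ, if_true, mul_one, Set.setOf_true, Set.univ_inter] at h
    exact h
  have hNX : rcPartitionFunction G p q B * φ.real (X ∩ C) =
      ∑ η ∈ U.powerset, rcWeight G p q B (η ∪ ζ₀) *
        (if (↑η : Percolation.BondConfig V) ∈ A then 1 else 0) := by
    have h := rcPartitionFunction_mul_real_inter_cylinder G hp hq0 B hU hζ₀E A
    rw [hζ₀] at h
    exact h
  rcases eq_or_lt_of_le (measureReal_nonneg : 0 ≤ φ.real C) with hC0 | hCpos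
  · have h0 : φ.real (X ∩ C) = 0 :=
      le_antisymm ((measureReal_mono Set.inter_subset_right (measure_ne_top φ C)).trans hC0.symm.le)
        measureReal_nonneg
    rw [h0, ← hC0, zero_mul]
  have hNpos : 0 < N := by rw [← hNC]; exact mul_pos hZ hCpos
  -- Holley's inequality on the lattice of all edge sets
  set f : Finset (Sym2 V) → ℝ := fun a ↦ if a ⊆ U then rcWeight G p q B (a ∪ ζ₀) / N else 0 with hf
  set g : Finset (Sym2 V) → ℝ := fun b ↦
    (if b ⊆ U then rcWeight GU p q W b else 0) / rcPartitionFunction GU p q W with hg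
  set μ : Finset (Sym2 V) → ℝ := fun a ↦ if (↑a : Percolation.BondConfig V) ∈ A then 1 else 0 with hμ
  have hf0 : 0 ≤ f := fun a ↦ by
    simp only [hf]
    split_ifs
    · exact div_nonneg (rcWeight_nonneg G hp hq0.le B _) hNpos.le
    · exact le_rfl
  have hg0 : 0 ≤ g := fun b ↦ by
    simp only [hg]
    split_ifs
    · exact div_nonneg (rcWeight_nonneg GU hp hq0.le W _) hZU.le
    · rw [zero_div]; exact le_rfl
  have hμ0 : 0 ≤ μ := fun a ↦ by simp only [hμ, Pi.zero_apply]; split_ifs <;> norm_num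
  have hμm : Monotone μ := by
    intro a b hab
    simp only [hμ]
    by_cases ha : (↑a : Percolation.BondConfig V) ∈ A
    · have hb : (↑b : Percolation.BondConfig V) ∈ A := hA (Finset.coe_subset.2 hab) ha
      simp [ha, hb]
    · simp only [ha, if_false]; split_ifs <;> norm_num
  -- sums over the whole lattice are sums over `U.powerset`
  have hfilter : (Finset.univ : Finset (Finset (Sym2 V))).filter (· ⊆ U) = U.powerset := by
    ext ω; simp
  have hsumf : ∀ F : Finset (Sym2 V) → ℝ,
      ∑ a, F a * f a = (∑ a ∈ U.powerset, rcWeight G p q B (a ∪ ζ₀) * F a) / N := by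
    intro F
    rw [Finset.sum_div, ← hfilter, Finset.sum_filter]
    refine Finset.sum_congr rfl fun a _ ↦ ?_
    simp only [hf]
    split_ifs <;> ring
  have hsumg : ∀ F : Finset (Sym2 V) → ℝ,
      ∑ b, F b * g b = ∑ b ∈ U.powerset, F b * (rcWeight GU p q W b / rcPartitionFunction GU p q W) := by
    intro F
    rw [← hfilter, Finset.sum_filter]
    refine Finset.sum_congr rfl fun b _ ↦ ?_
    simp only [hg]
    split_ifs <;> simp
  have hfsum : ∑ a, f a = 1 := by
    have h := hsumf fun _ ↦ 1
    simp only [one_mul, mul_one] at h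
    rw [h, ← hN, div_self hNpos.ne']
  have hgsum : ∑ b, g b = 1 := by
    have h := hsumg fun _ ↦ 1
    simp only [one_mul] at h
    rw [h, ← Finset.sum_div, div_eq_one_iff_eq hZU.ne', rcPartitionFunction, hEU]
  -- Holley's condition
  have hcond : ∀ a b, f a * g b ≤ f (a ⊓ b) * g (a ⊔ b) := by
    intro a b
    have hrhs : 0 ≤ f (a ⊓ b) * g (a ⊔ b) := mul_nonneg (hf0 _) (hg0 _)
    by_cases ha : a ⊆ U
    swap
    · simp only [hf, if_neg ha, zero_mul]; exact hrhs
    by_cases hb : b ⊆ U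
    swap
    · have : g b = 0 := by simp only [hg, if_neg hb, zero_div]
      rw [this, mul_zero]; exact hrhs
    have hab : a ⊓ b ⊆ U := Finset.inter_subset_left.trans ha
    have hab' : a ⊔ b ⊆ U := Finset.union_subset ha hb
    simp only [hf, hg, if_pos ha, if_pos hb, if_pos hab, if_pos hab']
    rw [div_mul_div_comm, div_mul_div_comm]
    refine div_le_div_of_nonneg_right ?_ (mul_pos hNpos hZU).le
    -- the weight inequality `w_G(a ∪ ζ₀) w_U(b) ≤ w_G((a ∩ b) ∪ ζ₀) w_U(a ∪ b)`
    rw [Finset.inf_eq_inter, Finset.sup_eq_union]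
    simp only [rcWeight, hEU]
    have haE : a ⊆ G.edgeFinset := ha.trans hU
    have hζE : ζ₀ ⊆ G.edgeFinset := hζ₀E.trans sdiff_subset
    have hdisj : Disjoint a ζ₀ := (hζ₀U.symm).mono_left ha
    have hdisj' : Disjoint (a ∩ b) ζ₀ := hdisj.mono_left Finset.inter_subset_left
    have h1 : #(a ∪ ζ₀) = #a + #ζ₀ := Finset.card_union_of_disjoint hdisj
    have h2 : #(a ∩ b ∪ ζ₀) = #(a ∩ b) + #ζ₀ := Finset.card_union_of_disjoint hdisj'
    have h3 : #(G.edgeFinset \ (a ∪ ζ₀)) = #G.edgeFinset - #(a ∪ ζ₀) :=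
      card_sdiff_of_subset (Finset.union_subset haE hζE)
    have h4 : #(G.edgeFinset \ (a ∩ b ∪ ζ₀)) = #G.edgeFinset - #(a ∩ b ∪ ζ₀) :=
      card_sdiff_of_subset (Finset.union_subset (Finset.inter_subset_left.trans haE) hζE)
    have h5 : #(U \ b) = #U - #b := card_sdiff_of_subset hb
    have h6 : #(U \ (a ∪ b)) = #U - #(a ∪ b) := card_sdiff_of_subset hab'
    have h7 : #(a ∪ ζ₀) ≤ #G.edgeFinset := card_le_card (Finset.union_subset haE hζE)
    have h8 : #(a ∪ b) ≤ #U := card_le_card hab'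
    have h9 : #(a ∩ b) ≤ #a := card_le_card Finset.inter_subset_left
    have h10 : #a + #b = #(a ∩ b) + #(a ∪ b) := by
      rw [add_comm (#(a ∩ b)), Finset.card_union_add_card_inter]
    obtain ⟨m, hm⟩ : ∃ m, #a = #(a ∩ b) + m := Nat.exists_eq_add_of_le h9
    have e1 : #(a ∪ ζ₀) = #(a ∩ b ∪ ζ₀) + m := by omega
    have e2 : #(U \ b) = #(U \ (a ∪ b)) + m := by omega
    have e3 : #(G.edgeFinset \ (a ∩ b ∪ ζ₀)) = #(G.edgeFinset \ (a ∪ ζ₀)) + m := by omega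
    have e4 : #(a ∪ b) = #b + m := by omega
    rw [e1, e2, e3, e4]
    have hki : clusterCount (↑(a ∪ ζ₀) : Percolation.BondConfig V) B ≤
        clusterCount (↑(a ∩ b ∪ ζ₀) : Percolation.BondConfig V) B :=
      clusterCount_anti (Finset.coe_subset.2
        (Finset.union_subset_union Finset.inter_subset_left le_rfl)) B
    have hku : clusterCount (↑(a ∪ b) : Percolation.BondConfig V) W ≤
        clusterCount (↑b : Percolation.BondConfig V) W :=
      clusterCount_anti (Finset.coe_subset.2 Finset.subset_union_right) W
    have hk : clusterCount (↑(a ∪ ζ₀) : Percolation.BondConfig V) B +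
        clusterCount (↑b : Percolation.BondConfig V) W ≤
        clusterCount (↑(a ∩ b ∪ ζ₀) : Percolation.BondConfig V) B +
          clusterCount (↑(a ∪ b) : Percolation.BondConfig V) W := by
      rw [Finset.coe_union, Finset.coe_union, Finset.coe_union, Finset.coe_inter]
      exact clusterCount_union_add_clusterCount_le hBW hξW'
    exact rcWeight_holley_aux hp.1 le_rfl hp.2 hq0.le le_rfl hq hki hku hk
  have key := _root_.holley f g μ hμ0 hf0 hg0 hμm (hfsum.trans hgsum.symm) hcond
  -- identify the two sides
  have hlhs : ∑ a, μ a * f a = φ.real (X ∩ C) / φ.real C := by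
    rw [hsumf, ← mul_div_mul_left (φ.real (X ∩ C)) (φ.real C) hZ.ne', hNC]
    congr 1
    exact hNX.symm
  have hrhs : ∑ b, μ b * g b = (rcMeasure GU p q W).real A := by
    rw [rcMeasure_real_eq_sum_indicator_mul GU hp hq0 W A]
    refine Finset.sum_congr rfl fun b _ ↦ ?_
    rw [hEU]
  rw [hlhs, hrhs, div_le_iff₀ hCpos] at key
  linarith [key, mul_comm (φ.real C) ((rcMeasure GU p q W).real A)]

/-! ### Domination of the conditional law, decreasing events -/

/-- **Conditionally on the configuration off a region, decreasing events inside the region are at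
most as likely as under the measure of the region wired on `B` only** (all edges off the region
closed: Grimmett 2006, Lemma (4.13) with Lemma (4.14)(b), `φ^0_Λ ≤_st φ^ξ_Λ`; DCS 2012, Thm. 3.1):
for `U ⊆ E(G)`, any configuration `ξ`, and every decreasing event `D`,
`φ^B_{G,p,q}({ω ∩ U ∈ D} ∩ {ω ∖ U = ξ}) ≤ φ^B_{G,p,q}({ω ∖ U = ξ}) · φ^B_{⟨U⟩,p,q}(D)`
(`0 ≤ p ≤ 1`, `q ≥ 1`). Holley's inequality with `clusterCount_add_clusterCount_union_le`.
[cite: Grimmett2006, Lemma (4.13) and Lemma (4.14)(b)] -/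
theorem rcMeasure_real_inter_cylinder_le_mul_fromEdgeSet_of_isLowerSet {p q : ℝ}
    (hp : p ∈ Set.Icc (0 : ℝ) 1) (hq : 1 ≤ q) (B : Set V) (U : Finset (Sym2 V))
    (hU : U ⊆ G.edgeFinset) (ξ : Set (Sym2 V)) {D : Set (Percolation.BondConfig V)}
    (hD : IsLowerSet D) :
    (rcMeasure G p q B).real ({ω | ω ∩ ↑U ∈ D} ∩ {ω | ω ∩ (↑U : Set (Sym2 V))ᶜ = ξ}) ≤
      (rcMeasure G p q B).real {ω | ω ∩ (↑U : Set (Sym2 V))ᶜ = ξ} *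
        (rcMeasure (fromEdgeSet (U : Set (Sym2 V))) p q B).real D := by
  classical
  have hq0 : 0 < q := one_pos.trans_le hq
  have hZ := rcPartitionFunction_pos G hp hq0 B
  haveI : IsProbabilityMeasure (rcMeasure G p q B) := isProbabilityMeasure_rcMeasure G hp hq0 B
  set φ := rcMeasure G p q B with hφ
  set X : Set (Percolation.BondConfig V) := {ω | ω ∩ ↑U ∈ D} with hX
  set X' : Set (Percolation.BondConfig V) := {ω | ω ∩ ↑U ∈ Dᶜ} with hX'
  set C : Set (Percolation.BondConfig V) := {ω | ω ∩ (↑U : Set (Sym2 V))ᶜ = ξ} with hC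
  by_cases hex : ∃ ω₀ : Finset (Sym2 V), ω₀ ⊆ G.edgeFinset ∧ (↑ω₀ : Set (Sym2 V)) ∩ (↑U)ᶜ = ξ
  swap
  · have hC0 : φ.real C = 0 := by
      rw [hφ, rcMeasure_real_apply G hp hq0 B C]
      refine Finset.sum_eq_zero fun ω hω ↦ if_neg fun hωC ↦ hex ⟨ω, Finset.mem_powerset.1 hω, hωC⟩
    have h0 : φ.real (X ∩ C) = 0 :=
      le_antisymm ((measureReal_mono Set.inter_subset_right (measure_ne_top φ C)).trans hC0.le)
        measureReal_nonneg
    rw [h0, hC0, zero_mul]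
  obtain ⟨ω₀, hω₀E, hω₀⟩ := hex
  set ζ₀ : Finset (Sym2 V) := ω₀ \ U with hζ₀def
  have hζ₀ : (↑ζ₀ : Set (Sym2 V)) = ξ := by rw [hζ₀def, Finset.coe_sdiff]; exact hω₀
  have hζ₀E : ζ₀ ⊆ G.edgeFinset \ U := Finset.sdiff_subset_sdiff hω₀E le_rfl
  have hζ₀U : Disjoint ζ₀ U := Finset.disjoint_of_subset_left hζ₀E sdiff_disjoint
  set GU : SimpleGraph V := fromEdgeSet (U : Set (Sym2 V)) with hGU
  have hEU : ∀ i : Fintype GU.edgeSet, @SimpleGraph.edgeFinset V GU i = U := fun i ↦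
    @edgeFinset_fromEdgeSet_of_subset V _ G _ U hU i
  have hZU := rcPartitionFunction_pos GU hp hq0 B
  set N : ℝ := ∑ η ∈ U.powerset, rcWeight G p q B (η ∪ ζ₀) with hN
  have hNC : rcPartitionFunction G p q B * φ.real C = N := by
    have h := rcPartitionFunction_mul_real_inter_cylinder G hp hq0 B hU hζ₀E
      (Set.univ : Set (Percolation.BondConfig V))
    rw [hζ₀] at h
    simp only [Set.mem_univ, if_true, mul_one, Set.setOf_true, Set.univ_inter] at h
    exact h
  have hNX' : rcPartitionFunction G p q B * φ.real (X' ∩ C) =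
      ∑ η ∈ U.powerset, rcWeight G p q B (η ∪ ζ₀) *
        (if (↑η : Percolation.BondConfig V) ∈ Dᶜ then 1 else 0) := by
    have h := rcPartitionFunction_mul_real_inter_cylinder G hp hq0 B hU hζ₀E Dᶜ
    rw [hζ₀] at h
    exact h
  rcases eq_or_lt_of_le (measureReal_nonneg : 0 ≤ φ.real C) with hC0 | hCpos
  · have h0 : φ.real (X ∩ C) = 0 :=
      le_antisymm ((measureReal_mono Set.inter_subset_right (measure_ne_top φ C)).trans hC0.symm.le)
        measureReal_nonneg
    rw [h0, ← hC0, zero_mul]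
  have hNpos : 0 < N := by rw [← hNC]; exact mul_pos hZ hCpos
  -- Holley with the roles swapped: `f` = weights of `⟨U⟩` wired on `B`, `g` = conditional weights,
  -- tested against the increasing indicator of `Dᶜ`
  set g : Finset (Sym2 V) → ℝ := fun a ↦ if a ⊆ U then rcWeight G p q B (a ∪ ζ₀) / N else 0 with hg
  set f : Finset (Sym2 V) → ℝ := fun b ↦
    (if b ⊆ U then rcWeight GU p q B b else 0) / rcPartitionFunction GU p q B with hf
  set μ : Finset (Sym2 V) → ℝ := fun a ↦ if (↑a : Percolation.BondConfig V) ∈ Dᶜ then 1 else 0 with hμ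
  have hg0 : 0 ≤ g := fun a ↦ by
    simp only [hg]
    split_ifs
    · exact div_nonneg (rcWeight_nonneg G hp hq0.le B _) hNpos.le
    · exact le_rfl
  have hf0 : 0 ≤ f := fun b ↦ by
    simp only [hf]
    split_ifs
    · exact div_nonneg (rcWeight_nonneg GU hp hq0.le B _) hZU.le
    · rw [zero_div]; exact le_rfl
  have hμ0 : 0 ≤ μ := fun a ↦ by simp only [hμ, Pi.zero_apply]; split_ifs <;> norm_num
  have hDc : IsUpperSet Dᶜ := hD.compl
  have hμm : Monotone μ := by
    intro a b hab
    simp only [hμ]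
    by_cases ha : (↑a : Percolation.BondConfig V) ∈ Dᶜ
    · have hb : (↑b : Percolation.BondConfig V) ∈ Dᶜ := hDc (Finset.coe_subset.2 hab) ha
      simp [ha, hb]
    · simp only [ha, if_false]; split_ifs <;> norm_num
  have hfilter : (Finset.univ : Finset (Finset (Sym2 V))).filter (· ⊆ U) = U.powerset := by
    ext ω; simp
  have hsumg : ∀ F : Finset (Sym2 V) → ℝ,
      ∑ a, F a * g a = (∑ a ∈ U.powerset, rcWeight G p q B (a ∪ ζ₀) * F a) / N := by
    intro F
    rw [Finset.sum_div, ← hfilter, Finset.sum_filter]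
    refine Finset.sum_congr rfl fun a _ ↦ ?_
    simp only [hg]
    split_ifs <;> ring
  have hsumf : ∀ F : Finset (Sym2 V) → ℝ,
      ∑ b, F b * f b = ∑ b ∈ U.powerset, F b * (rcWeight GU p q B b / rcPartitionFunction GU p q B) := by
    intro F
    rw [← hfilter, Finset.sum_filter]
    refine Finset.sum_congr rfl fun b _ ↦ ?_
    simp only [hf]
    split_ifs <;> simp
  have hgsum : ∑ a, g a = 1 := by
    have h := hsumg fun _ ↦ 1
    simp only [one_mul, mul_one] at h
    rw [h, ← hN, div_self hNpos.ne']
  have hfsum : ∑ b, f b = 1 := by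
    have h := hsumf fun _ ↦ 1
    simp only [one_mul] at h
    rw [h, ← Finset.sum_div, div_eq_one_iff_eq hZU.ne', rcPartitionFunction, hEU]
  have hcond : ∀ a b, f a * g b ≤ f (a ⊓ b) * g (a ⊔ b) := by
    intro a b
    have hrhs : 0 ≤ f (a ⊓ b) * g (a ⊔ b) := mul_nonneg (hf0 _) (hg0 _)
    by_cases hb : b ⊆ U
    swap
    · simp only [hg, if_neg hb, mul_zero]; exact hrhs
    by_cases ha : a ⊆ U
    swap
    · have : f a = 0 := by simp only [hf, if_neg ha, zero_div]
      rw [this, zero_mul]; exact hrhs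
    have hab : a ⊓ b ⊆ U := Finset.inter_subset_left.trans ha
    have hab' : a ⊔ b ⊆ U := Finset.union_subset ha hb
    simp only [hf, hg, if_pos ha, if_pos hb, if_pos hab, if_pos hab']
    rw [div_mul_div_comm, div_mul_div_comm]
    refine div_le_div_of_nonneg_right ?_ (mul_pos hZU hNpos).le
    -- the weight inequality `w_U(a) w_G(b ∪ ζ₀) ≤ w_U(a ∩ b) w_G((a ∪ b) ∪ ζ₀)`
    rw [Finset.inf_eq_inter, Finset.sup_eq_union]
    simp only [rcWeight, hEU]
    have hbE : b ⊆ G.edgeFinset := hb.trans hU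
    have habE : a ∪ b ⊆ G.edgeFinset := hab'.trans hU
    have hζE : ζ₀ ⊆ G.edgeFinset := hζ₀E.trans sdiff_subset
    have hdisj : Disjoint b ζ₀ := (hζ₀U.symm).mono_left hb
    have hdisj' : Disjoint (a ∪ b) ζ₀ := (hζ₀U.symm).mono_left hab'
    have h1 : #(b ∪ ζ₀) = #b + #ζ₀ := Finset.card_union_of_disjoint hdisj
    have h2 : #(a ∪ b ∪ ζ₀) = #(a ∪ b) + #ζ₀ := Finset.card_union_of_disjoint hdisj'
    have h3 : #(G.edgeFinset \ (b ∪ ζ₀)) = #G.edgeFinset - #(b ∪ ζ₀) :=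
      card_sdiff_of_subset (Finset.union_subset hbE hζE)
    have h4 : #(G.edgeFinset \ (a ∪ b ∪ ζ₀)) = #G.edgeFinset - #(a ∪ b ∪ ζ₀) :=
      card_sdiff_of_subset (Finset.union_subset habE hζE)
    have h5 : #(U \ a) = #U - #a := card_sdiff_of_subset ha
    have h6 : #(U \ (a ∩ b)) = #U - #(a ∩ b) := card_sdiff_of_subset hab
    have h7 : #(a ∪ b ∪ ζ₀) ≤ #G.edgeFinset := card_le_card (Finset.union_subset habE hζE)
    have h8 : #a ≤ #U := card_le_card ha
    have h9 : #(a ∩ b) ≤ #a := card_le_card Finset.inter_subset_left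
    have h10 : #a + #b = #(a ∩ b) + #(a ∪ b) := by
      rw [add_comm (#(a ∩ b)), Finset.card_union_add_card_inter]
    obtain ⟨m, hm⟩ : ∃ m, #a = #(a ∩ b) + m := Nat.exists_eq_add_of_le h9
    have e1 : #(U \ (a ∩ b)) = #(U \ a) + m := by omega
    have e2 : #(a ∪ b ∪ ζ₀) = #(b ∪ ζ₀) + m := by omega
    have e3 : #(G.edgeFinset \ (b ∪ ζ₀)) = #(G.edgeFinset \ (a ∪ b ∪ ζ₀)) + m := by omega
    rw [hm, e1, e2, e3]
    have hki : clusterCount (↑a : Percolation.BondConfig V) B ≤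
        clusterCount (↑(a ∩ b) : Percolation.BondConfig V) B :=
      clusterCount_anti (Finset.coe_subset.2 Finset.inter_subset_left) B
    have hku : clusterCount (↑(a ∪ b ∪ ζ₀) : Percolation.BondConfig V) B ≤
        clusterCount (↑(b ∪ ζ₀) : Percolation.BondConfig V) B :=
      clusterCount_anti (Finset.coe_subset.2
        (Finset.union_subset_union Finset.subset_union_right le_rfl)) B
    have hk : clusterCount (↑a : Percolation.BondConfig V) B +
        clusterCount (↑(b ∪ ζ₀) : Percolation.BondConfig V) B ≤
        clusterCount (↑(a ∩ b) : Percolation.BondConfig V) B +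
          clusterCount (↑(a ∪ b ∪ ζ₀) : Percolation.BondConfig V) B := by
      rw [Finset.coe_union, Finset.coe_union, Finset.coe_union, Finset.coe_inter]
      exact clusterCount_add_clusterCount_union_le le_rfl
    exact rcWeight_holley_aux hp.1 le_rfl hp.2 hq0.le le_rfl hq hki hku hk
  have key := _root_.holley f g μ hμ0 hf0 hg0 hμm (hfsum.trans hgsum.symm) hcond
  -- identify the two sides: `ν(Dᶜ) ≤ φ(Dᶜ | C)`, i.e. `φ(D | C) ≤ ν(D)`
  haveI : IsProbabilityMeasure (rcMeasure GU p q B) := isProbabilityMeasure_rcMeasure GU hp hq0 B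
  have hlhs : ∑ b, μ b * f b = (rcMeasure GU p q B).real Dᶜ := by
    rw [rcMeasure_real_eq_sum_indicator_mul GU hp hq0 B Dᶜ]
    refine Finset.sum_congr rfl fun b _ ↦ ?_
    rw [hEU]
  have hrhs : ∑ a, μ a * g a = φ.real (X' ∩ C) / φ.real C := by
    rw [hsumg, ← mul_div_mul_left (φ.real (X' ∩ C)) (φ.real C) hZ.ne', hNC]
    congr 1
    exact hNX'.symm
  rw [hlhs, hrhs, le_div_iff₀ hCpos] at key
  -- complements: `φ(X' ∩ C) = φ(C) - φ(X ∩ C)`, `ν(Dᶜ) = 1 - ν(D)`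
  have hsplit : φ.real (X' ∩ C) = φ.real C - φ.real (X ∩ C) := by
    have hdisj : Disjoint (X ∩ C) (X' ∩ C) := Set.disjoint_left.2 fun ω h₁ h₂ ↦ h₂.1 h₁.1
    have hunion : (X ∩ C) ∪ (X' ∩ C) = C := by
      ext ω
      simp only [hX, hX', Set.mem_union, Set.mem_inter_iff, Set.mem_setOf_eq, Set.mem_compl_iff]
      tauto
    have h := measureReal_union (μ := φ) hdisj MeasurableSet.of_discrete
    rw [hunion] at h
    linarith
  have hcompl : (rcMeasure GU p q B).real Dᶜ = 1 - (rcMeasure GU p q B).real D :=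
    probReal_compl_eq_one_sub MeasurableSet.of_discrete
  rw [hsplit, hcompl] at key
  nlinarith [key, measureReal_nonneg (μ := φ) (s := C)]


/-! ### Conditioning on the edges off the region being closed: the deleted graph, with equality -/

/-- For `η ⊆ U ⊆ E(G)` the weight of `η` in `G` and in the spanning graph `⟨U⟩` differ by the
constant factor `(1 - p)^{|E(G) ∖ U|}` of the closed edges off `U` (same open edges, same
clusters). [cite: Grimmett2006, Thm. (3.1)(a), eq. (3.2)] -/
theorem rcWeight_eq_pow_mul_rcWeight_fromEdgeSet (p q : ℝ) (B : Set V) {U η : Finset (Sym2 V)}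
    (hU : U ⊆ G.edgeFinset) (hη : η ⊆ U) :
    rcWeight G p q B η =
      (1 - p) ^ #(G.edgeFinset \ U) * rcWeight (fromEdgeSet (U : Set (Sym2 V))) p q B η := by
  have hEU : ∀ i : Fintype (fromEdgeSet (U : Set (Sym2 V))).edgeSet,
      @SimpleGraph.edgeFinset V (fromEdgeSet (U : Set (Sym2 V))) i = U := fun i ↦
    @edgeFinset_fromEdgeSet_of_subset V _ G _ U hU i
  simp only [rcWeight, hEU]
  have h1 : #(G.edgeFinset \ η) = #(U \ η) + #(G.edgeFinset \ U) := by
    rw [card_sdiff_of_subset (hη.trans hU), card_sdiff_of_subset hη, card_sdiff_of_subset hU]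
    have := card_le_card hη
    have := card_le_card hU
    omega
  rw [h1, pow_add]
  ring

/-- **Domain Markov property with closed outside, for the measure** (Grimmett 2006, Thm. (3.1)(a),
eq. (3.2), case `j = 0`: "`φ_{G,p,q}(· | ω(e) = 0) = φ_{G∖e,p,q}`", applied to every edge off the
region; Lemma (4.13) with the free boundary condition `ξ = 0`; Duminil-Copin–Smirnov 2012, §3.2):
conditionally on *all edges off `U` being closed*, the configuration inside `U` has exactly the
law of the random-cluster measure of the spanning graph `⟨U⟩` with the same wired set `B` — here
multiplied out, `φ^B_G({ω ∩ U ∈ A} ∩ {ω ∖ U = ∅}) = φ^B_G({ω ∖ U = ∅}) · φ^B_{⟨U⟩}(A)` for every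
event `A` (`0 ≤ p ≤ 1`, `q > 0`; both sides vanish when `p = 1` and `U ≠ E(G)`). Together with
`rcMeasure_real_upper_inter_lower` this gives `φ^B_{⟨U⟩}(A) ≤ φ^B_G({ω ∩ U ∈ A})` for increasing
`A` and `q ≥ 1` (`rcMeasure_fromEdgeSet_real_le`). [cite: Grimmett2006, Thm. (3.1)(a) and Lemma (4.13)] -/
theorem rcMeasure_real_inter_cylinder_empty_eq_mul_fromEdgeSet {p q : ℝ} (hp : p ∈ Set.Icc (0 : ℝ) 1)
    (hq : 0 < q) (B : Set V) (U : Finset (Sym2 V)) (hU : U ⊆ G.edgeFinset)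
    (A : Set (Percolation.BondConfig V)) :
    (rcMeasure G p q B).real ({ω | ω ∩ ↑U ∈ A} ∩ {ω | ω ∩ (↑U : Set (Sym2 V))ᶜ = ∅}) =
      (rcMeasure G p q B).real {ω | ω ∩ (↑U : Set (Sym2 V))ᶜ = ∅} *
        (rcMeasure (fromEdgeSet (U : Set (Sym2 V))) p q B).real A := by
  classical
  have hZ := rcPartitionFunction_pos G hp hq B
  set GU : SimpleGraph V := fromEdgeSet (U : Set (Sym2 V)) with hGU
  have hEU : ∀ i : Fintype GU.edgeSet, @SimpleGraph.edgeFinset V GU i = U := fun i ↦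
    @edgeFinset_fromEdgeSet_of_subset V _ G _ U hU i
  haveI : IsProbabilityMeasure (rcMeasure GU p q B) := isProbabilityMeasure_rcMeasure GU hp hq B
  have h0 : (∅ : Finset (Sym2 V)) ⊆ G.edgeFinset \ U := Finset.empty_subset _
  -- `Z_G φ_G({ω ∩ U ∈ A'} ∩ {ω ∖ U = ∅}) = (1-p)^{|E∖U|} Z_U φ_U(A')`
  have key : ∀ A' : Set (Percolation.BondConfig V), rcPartitionFunction G p q B *
      (rcMeasure G p q B).real ({ω | ω ∩ ↑U ∈ A'} ∩ {ω | ω ∩ (↑U : Set (Sym2 V))ᶜ = ∅}) =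
      (1 - p) ^ #(G.edgeFinset \ U) *
        (rcPartitionFunction GU p q B * (rcMeasure GU p q B).real A') := by
    intro A'
    have h := rcPartitionFunction_mul_real_inter_cylinder G hp hq B hU h0 A'
    rw [Finset.coe_empty] at h
    rw [h]
    have h2 : rcPartitionFunction GU p q B * (rcMeasure GU p q B).real A' =
        ∑ η ∈ U.powerset, rcWeight GU p q B η *
          (if (↑η : Percolation.BondConfig V) ∈ A' then 1 else 0) := by
      rw [rcMeasure_real_apply GU hp hq B A', Finset.mul_sum, hEU]
      refine Finset.sum_congr rfl fun η _ ↦ ?_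
      have hZU := (rcPartitionFunction_pos GU hp hq B).ne'
      split_ifs
      · field_simp
      · simp
    rw [h2, Finset.mul_sum]
    refine Finset.sum_congr rfl fun η hη ↦ ?_
    rw [Finset.union_empty,
      rcWeight_eq_pow_mul_rcWeight_fromEdgeSet G p q B hU (Finset.mem_powerset.1 hη)]
    ring
  have k1 := key A
  have k2 := key Set.univ
  simp only [Set.mem_univ, Set.setOf_true, Set.univ_inter, probReal_univ, mul_one] at k2
  apply mul_left_cancel₀ hZ.ne'
  rw [k1, ← mul_assoc (rcPartitionFunction G p q B), k2]
  ring

/-- **The measure of the region (outside closed) is dominated by the ambient measure on increasing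
events** (Grimmett 2006, Lemma (4.14)(a)-type monotonicity in the domain for the free-outside
boundary condition; from the closed-outside domain Markov property and the negative correlation of
increasing and decreasing events, `rcMeasure_real_upper_inter_lower`): for `U ⊆ E(G)`, `q ≥ 1`
and increasing `A`, `φ^B_{⟨U⟩,p,q}(A) ≤ φ^B_{G,p,q}({ω ∩ U ∈ A})` — provided the conditioning event
"all edges off `U` closed" is not null (`p < 1`, or `U = E(G)`).
[cite: Grimmett2006, Thm. (3.1)(a) and Lemma (4.14)] -/
theorem rcMeasure_fromEdgeSet_real_le {p q : ℝ} (hp : p ∈ Set.Icc (0 : ℝ) 1) (hq : 1 ≤ q)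
    (B : Set V) (U : Finset (Sym2 V)) (hU : U ⊆ G.edgeFinset)
    (h0 : 0 < (rcMeasure G p q B).real {ω | ω ∩ (↑U : Set (Sym2 V))ᶜ = ∅})
    {A : Set (Percolation.BondConfig V)} (hA : IsUpperSet A) :
    (rcMeasure (fromEdgeSet (U : Set (Sym2 V))) p q B).real A ≤
      (rcMeasure G p q B).real {ω | ω ∩ ↑U ∈ A} := by
  have hq0 : 0 < q := one_pos.trans_le hq
  have heq := rcMeasure_real_inter_cylinder_empty_eq_mul_fromEdgeSet G hp hq0 B U hU A
  -- `{ω ∖ U = ∅}` is decreasing, `{ω ∩ U ∈ A}` is increasing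
  have hD : IsLowerSet {ω : Percolation.BondConfig V | ω ∩ (↑U : Set (Sym2 V))ᶜ = ∅} := by
    intro ω₁ ω₂ h h₁
    simp only [Set.mem_setOf_eq] at h₁ ⊢
    exact Set.eq_empty_of_subset_empty (h₁ ▸ Set.inter_subset_inter_left _ h)
  have hA' : IsUpperSet {ω : Percolation.BondConfig V | ω ∩ ↑U ∈ A} := fun ω₁ ω₂ h h₁ ↦
    hA (Set.inter_subset_inter_left _ h) h₁
  have hle := rcMeasure_real_upper_inter_lower G hp hq B hA' hD
  rw [heq, mul_comm] at hle
  exact le_of_mul_le_mul_right hle h0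

end Finite

end Literature.Probability.LatticeModels

end
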